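import Summits.QuantumFields.YangMills.Theorems.UnitScaleTiltHalvingP1FlatCoreTopStep
import Literature.MathematicalPhysics.QuantumFieldTheory.Balaban1983to89.B8Prop5JoinSectELocalRDTraceFree
import Literature.MathematicalPhysics.QuantumFieldTheory.Balaban1983to89.B8TraceLogProduct
import HarnessLib

/-!
# `UnitScaleTiltHalvingP1FlatCoreTopStepTraceFree` — line H (`BirthV10.stub_halvingStep`, stmt-QuantumFields-19200), LEAD-H RULING L-10 (τ-2):
# the τ-TWINS of the restriction-agnostic JOIN-B (`HalvingP1FlatCoreTopStep.hFP_kLevel_agnostic_RD` ∕ `hFP_kLevel_ofConstraint_RD`, ✓p626260) —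
# the SAME re-run over the lit base's JOIN-A WITH THE TRACE-FREE CLAUSE (`B8Prop5GaugeParamTraceFree.gaugeParam_kLevel_traceFree`, layer 2a of
# `B8Prop5JoinSectELocalRDTraceFree.hFP_kLevel_of179_local_RD_traceFree`): for every continuous TRACIAL functional `τ`, a `τ`-free datum `D*A` on the
# `Ω_j`, a `τ`-compatible correction `H_c` on the ¼α₄-ball and `τ`-compatible letters `G′`, `R = 1 − G′Q′ᵀCQ′G′`, Proposition 5's fixed point `λ′` is
# `τ`-FREE at every site — so that the H-line's top step can be read in `𝔰𝔲(2)` (`τ = tr`: `e^{iλ′} ∈ SU(2)`), closing the located [R-f]-TRACELESS gap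
# («✓p636261 yields `IsSelfAdjoint (lam x)` only; `trace (lam x) = 0` is FORCED») one storey below the Sect.-E family (file `…TopStepFamilyTraceFree`)

WHY (cell `ym3-torus`, route `UnitScaleTilt`, crux `MinimiserStabilityRegPr` = stmt-QuantumFields-19200, line H = `hSupU` ⟸ nine content rows ✓p643656;
LEAD-H ★w5-19200 g4 RULING L-10 15:07:50Z + AMENDMENT 15:08:14Z: «we carry the τ-clause UP, we do NOT relax pillar (i) `trace (A b) = 0`»; τ-thread
(τ-1) `Cfam k` trace row (★w1-20520 g7) ∥ (τ-2) THIS FILE + `…TopStepFamilyTraceFree` (★w7-19936 g8) → (τ-3) `hFP_kLevel_top_RD_traceFree` (★w8-19936 g3)).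
LOCATED (this seat, 15:08–15:11Z): the lit base threads ONE more conjunct `∀ x, τ(λ′(x)) = 0` through JOIN-A (`gaugeParam_kLevel_traceFree`: the
contraction preserves the closed set of `τ`-free parameters) under four displayed `τ`-rows (`hDAτ hcτ hRτ hGτ`) and (T1) traciality; (T2)
`τ(log(eᵃeᵇ)) = τa + τb` is a THEOREM for tracial `τ` (✓`B8TraceLogProduct.hlog_of_tracial`), so it is NOT a binder here.  THIS FILE:
* §1 ★★ `hFP_kLevel_agnostic_RD_traceFree` — `hFP_kLevel_agnostic_RD` VERBATIM (letters `g Δ q qs Aw c` of [4] with `g_rightΩ` pointwise on `Ω₀` and `c_range`; `H_c` a free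
  letter with its eight binders; JOIN-B's windows; the datum `A`; (1.103)∕(1.106)) PLUS `τ` tracial and the four `τ`-rows; CONCLUSION: the raw fixed point `s` (¼α₄-ball,
  `Q′λ_s = 0`, `λ′ = λ_s + H_cλ_s`), `λ′` Hermitian, `= 0` off `Ω₀`, **`τ(λ′(x)) = 0` at every site**, (1.108) on `Eb j`, the multiplier form of the Landau equation on `Ω₀`;
* §1 ★★ `hFP_kLevel_ofConstraint_RD_traceFree` — the `P`-form (any restriction predicate transferred from `Q′λ_s = 0`), with the `τ`-conjunct.
HONEST FRAMING.  The proofs are ✓p626260's lines with JOIN-A replaced by its τ-twin; nothing of [4] ((1.91)–(1.101)), of [3] Prop. 10, of Sect. E's estimates or of the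
`τ`-rows themselves is proved here — they stay DISPLAYED; the Sect.-E family's `τ`-row (`hcτ` for `H_c = i(H′t̂ − H′D′(−iλ + H′t̂))`) is the sibling file's theorem.
Count-neutral helper (`--supports stmt-QuantumFields-19200 --as helper`); registry∕binders∕skeleton text untouched (J r4).  YM₃ on T³ is rung R3 of the programme, NOT the
Clay problem; nothing here is about d = 4, the continuum, or a mass gap; `hSupU`, the stub and the crux are NOT proved by this file.

References: T. Bałaban, Commun. Math. Phys. 99 (1985) 75–102 [Balaban1985RegularSpaces] (Prop. 5 (1.107)–(1.109) p.94, (1.95)–(1.106) pp.92–94, (1.113)–(1.114) p.95,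
(1.17) p.78 (`𝔤`-valued gauge parameters), p.76); Commun. Math. Phys. 98 (1985) 17–51 [Balaban1985Averaging] ((213)–(214) p.50).
-/

set_option autoImplicit false

noncomputable section

open NormedSpace Metric Set
open Complex (I)

namespace Summit.QuantumFields.YangMills.Theorems.HalvingP1FlatCoreTopStep

open Literature.MathematicalPhysics.QuantumFieldTheory.Balaban1983to89
open B7Prop1Explicit (e U1 expUnit val_expUnit)
open B7Prop2Explicit (unitaryUnits mem_unitaryUnits unitaryUnits_le_U1)
open B7Eq78Linearization (conjR)
open B7Eq92Concrete (mgauge mgauge_apply)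
open B8Ineq132 (covDerivFwd covDeriv BondTouches)
open B8Eq119TwistedAxial (Restr129 InAx)
open B8Eq138LandauZd (covLap covDivB QT IsLandau138W)
open B8Eq182Proof (gAd)
open B8Eq184Proof (gaugeExp cfgExp)
open B8Eq188Proof (frakF3 gAd_neg)
open B8LambdaSpaceKLevel (wt lamSubK lamOf norm_le_iff)
open B8Prop5ContractionKLevel (Bd2 Zsol Vop Wsrc PsiP5 Mc Kc)
open B8Prop5GaugeParamKLevel (gpar_size)
open B8Prop5GaugeParamTraceFree (gaugeParam_kLevel_traceFree)
open B8TraceLogProduct (hlog_of_tracial)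
open B8Prop5KLevelLetters (multiplier_iff_of_whyZ)
open B8Eq195Linear (proj325_sub)
open B8Eq195LinearRange (q_g_proj325_range)
open B8Prop5JoinHFP (covLap_neg')

-- `Site` alone could resolve to the torus sites of `Setup.lean`; use the `ℤ^d` sites of `B7Prop1Explicit`.
open B7Prop1Explicit (Site)

variable {d : ℕ} {𝔸 : Type*} [CStarAlgebra 𝔸] [Nontrivial 𝔸]

/-! ## §1 JOIN-B (RD letters), restriction-agnostic, WITH THE TRACE-FREE CLAUSE -/

section GenericTraceFree

variable {L k : ℕ} {η : ℝ} {Ω Λs : ℕ → Set (Site d)} {Eb : ℕ → Set (Site d × Fin d)} {U₀ : Site d → Fin d → 𝔸ˣ}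
  {A : Site d → Fin d → 𝔸}

/-- ★★ **PROPOSITION 5's FIXED POINT IN THE KNIT'S CURRENCY, RESTRICTION-AGNOSTIC, WITH THE TRACE-FREE CLAUSE** — `hFP_kLevel_agnostic_RD` (✓p626260) VERBATIM
PLUS a continuous tracial functional `τ` ((T1) `τ(xy) = τ(yx)`), a `τ`-free datum `D*A` on the `Ω_j` (`hDAτ`), a `τ`-compatible correction `H_c` on the ¼α₄-ball (`hcτ`) and
`τ`-compatible letters `R = 1 − G′Q′ᵀCQ′G′` (`hRτ`), `G′` (`hGτ`).  CONCLUSION: the raw fixed point `s` (¼α₄-ball of `lamSubK`), its LINEAR CONSTRAINT `Q′λ_s = 0`,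
`λ′ = λ_s + H_cλ_s`; `λ′` Hermitian, `= 0` off `Ω₀`, **`τ(λ′(x)) = 0` at every site**, (1.108) on `Eb j` (`j ≤ k`), and the multiplier form of the Landau equation on `Ω₀`.
Print: `λ′` is `𝔤`-valued ((1.17) p. 78); for `M_N(ℂ)`, `τ = tr`: traceless, whence `e^{iλ′} ∈ SU(N)`. [cite: Balaban1985RegularSpaces, Prop. 5 (1.107)–(1.109) p.94, (1.95)–(1.106) pp.92–94, (1.113)–(1.114) p.95, (1.17) p.78] -/
theorem hFP_kLevel_agnostic_RD_traceFree (hL : 1 ≤ L) (hη : 0 < η) (hU₀ : ∀ x κ, U₀ x κ ∈ unitaryUnits 𝔸)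
    (hEbΩ : ∀ j, j ≤ k → ∀ x ∈ Ω j, ∀ μ : Fin d, (x, μ) ∈ Eb j ∧ (x - e μ, μ) ∈ Eb j)
    -- letters of [4]
    (g Δ : (Site d → 𝔸) →ₗ[ℂ] (Site d → 𝔸)) (q : (Site d → 𝔸) →ₗ[ℂ] (ℕ → Site d → 𝔸)) (qs : (ℕ → Site d → 𝔸) →ₗ[ℂ] (Site d → 𝔸))
    (Aw c : (ℕ → Site d → 𝔸) →ₗ[ℂ] (ℕ → Site d → 𝔸))
    (g_rightΩ : ∀ x, ∀ y ∈ Ω 0, (Δ (g x) + qs (Aw (q (g x)))) y = x y)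
    (c_range : ∀ f, q (g (g (qs (c (q f))))) = q f)
    (hΔ : ∀ (f : Site d → 𝔸), ∀ x ∈ Ω 0, Δ f x = covLap η U₀ ((Ω 0).indicator f) x)
    (hqs : ∀ (μ : ℕ → Site d → 𝔸), ∀ x ∈ Ω 0, qs μ x = QT L k Λs U₀ μ x)
    (Hc : (Site d → 𝔸) → (Site d → 𝔸))
    -- JOIN-B's windows, letters G′/R, H_c's eight binders, the datum
    {α₄ BG BR h₀ h₁ h₂ l₀ l₁ l₂ cA cDA : ℝ}
    (hα₄ : 0 < α₄) (hBG : 0 ≤ BG) (hBR : 0 ≤ BR) (hh₀ : 0 ≤ h₀) (hh₂ : 0 ≤ h₂) (hl₀ : 0 ≤ l₀) (hl₁ : 0 ≤ l₁)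
    (hl₂ : 0 ≤ l₂) (hcA : 0 ≤ cA) (hcA' : cA ≤ 1 / 13) (hcDA : 0 ≤ cDA)
    (ha₁' : α₄ / 4 + h₀ ≤ 1 / 24) (hb₁' : α₄ / 4 + h₁ ≤ 1 / 140) (hb₁ : 0 < α₄ / 4 + h₁) (hθ : 10 * (α₄ / 4 + h₀) * BR ≤ 1 / 2)
    (hh₀' : h₀ ≤ 3 * α₄ / 4) (hh₁' : h₁ ≤ 3 * α₄ / 4)
    (hG : ∀ (f : Site d → 𝔸) (m : ℝ), 0 ≤ m → Bd2 L η k Ω f m →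
      (∀ x, ‖g f x‖ ≤ BG * m) ∧ ∀ j, j ≤ k → ∀ p ∈ Eb j, wt L η j * ‖covDerivFwd η U₀ p.2 (g f) p.1‖ ≤ BG * m)
    (hGsupp : ∀ (f : Site d → 𝔸) (x : Site d), x ∉ Ω 0 → g f x = 0)
    (hGreal : ∀ f : Site d → 𝔸, (∀ j, j ≤ k → ∀ x ∈ Ω j, IsSelfAdjoint (f x)) → ∀ x, IsSelfAdjoint (g f x))
    (hRbd : ∀ (f : Site d → 𝔸) (m : ℝ), 0 ≤ m → Bd2 L η k Ω f m → Bd2 L η k Ω (f - g (qs (c (q (g f))))) (BR * m))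
    (hRreal : ∀ f : Site d → 𝔸, (∀ j, j ≤ k → ∀ x ∈ Ω j, IsSelfAdjoint (f x)) →
      ∀ j, j ≤ k → ∀ x ∈ Ω j, IsSelfAdjoint ((f - g (qs (c (q (g f))))) x))
    (hc0 : ∀ s : lamSubK η U₀ L k Eb, ‖s‖ ≤ α₄ / 4 → ∀ x, ‖Hc (lamOf s) x‖ ≤ h₀)
    (hc1 : ∀ s : lamSubK η U₀ L k Eb, ‖s‖ ≤ α₄ / 4 → ∀ j, j ≤ k → ∀ p ∈ Eb j, wt L η j * ‖covDerivFwd η U₀ p.2 (Hc (lamOf s)) p.1‖ ≤ h₁)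
    (hc2 : ∀ s : lamSubK η U₀ L k Eb, ‖s‖ ≤ α₄ / 4 → Bd2 L η k Ω (covLap η U₀ (Hc (lamOf s))) h₂)
    (hcL0 : ∀ s t : lamSubK η U₀ L k Eb, ‖s‖ ≤ α₄ / 4 → ‖t‖ ≤ α₄ / 4 → ∀ x, ‖Hc (lamOf s) x - Hc (lamOf t) x‖ ≤ l₀ * ‖s - t‖)
    (hcL1 : ∀ s t : lamSubK η U₀ L k Eb, ‖s‖ ≤ α₄ / 4 → ‖t‖ ≤ α₄ / 4 → ∀ j, j ≤ k → ∀ p ∈ Eb j,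
      wt L η j * ‖covDerivFwd η U₀ p.2 (Hc (lamOf s) - Hc (lamOf t)) p.1‖ ≤ l₁ * ‖s - t‖)
    (hcL2 : ∀ s t : lamSubK η U₀ L k Eb, ‖s‖ ≤ α₄ / 4 → ‖t‖ ≤ α₄ / 4 →
      Bd2 L η k Ω (covLap η U₀ (Hc (lamOf s)) - covLap η U₀ (Hc (lamOf t))) (l₂ * ‖s - t‖))
    (hcsa : ∀ s : lamSubK η U₀ L k Eb, ‖s‖ ≤ α₄ / 4 → (∀ x, IsSelfAdjoint (lamOf s x)) → ∀ x, IsSelfAdjoint (Hc (lamOf s) x))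
    (hcsupp : ∀ s : lamSubK η U₀ L k Eb, ‖s‖ ≤ α₄ / 4 → ∀ x, x ∉ Ω 0 → Hc (lamOf s) x = 0)
    (hDA : Bd2 L η k Ω (fun y => covDivB η U₀ A y) cDA) (hDAsa : ∀ j, j ≤ k → ∀ x ∈ Ω j, IsSelfAdjoint (covDivB η U₀ A x))
    (hA : ∀ j, j ≤ k → ∀ x ∈ Ω j, ∀ μ : Fin d,
      wt L η j * ‖A x μ‖ ≤ cA ∧ wt L η j * ‖conjR (U₀ (x - e μ) μ)⁻¹ (A (x - e μ) μ)‖ ≤ cA)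
    (hAsa : ∀ x μ, IsSelfAdjoint (A x μ))
    (h103 : BG * Mc d BR (α₄ / 4 + h₁) cA h₂ cDA ≤ α₄ / 4)
    (h106 : BG * Kc d BR (α₄ / 4 + h₁) cA h₂ cDA l₂ (1 + l₀) (1 + l₁) ≤ 1 / 2)
    -- `τ`-freeness of the datum, the correction and the letters (joint J-SU; (T2) discharged by `hlog_of_tracial`)
    (τ : 𝔸 →L[ℂ] ℂ) (hτ : ∀ x y : 𝔸, τ (x * y) = τ (y * x))
    (hDAτ : ∀ j, j ≤ k → ∀ x ∈ Ω j, τ (covDivB η U₀ A x) = 0)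
    (hcτ : ∀ s : lamSubK η U₀ L k Eb, ‖s‖ ≤ α₄ / 4 → (∀ x, τ (lamOf s x) = 0) → ∀ x, τ (Hc (lamOf s) x) = 0)
    (hRτ : ∀ f : Site d → 𝔸, (∀ j, j ≤ k → ∀ x ∈ Ω j, τ (f x) = 0) →
      ∀ j, j ≤ k → ∀ x ∈ Ω j, τ ((f - g (qs (c (q (g f))))) x) = 0)
    (hGτ : ∀ f : Site d → 𝔸, (∀ j, j ≤ k → ∀ x ∈ Ω j, τ (f x) = 0) → ∀ x, τ (g f x) = 0) :
    ∃ (s : lamSubK η U₀ L k Eb) (lam : Site d → 𝔸), ‖s‖ ≤ α₄ / 4 ∧ q (lamOf s) = 0 ∧ lam = lamOf s + Hc (lamOf s) ∧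
      (∀ x, IsSelfAdjoint (lam x)) ∧ (∀ x, x ∉ Ω 0 → lam x = 0) ∧ (∀ x, τ (lam x) = 0) ∧
      (∀ j, j ≤ k → ∀ p ∈ Eb j, ‖lam p.1‖ ≤ α₄ ∧ wt L η j * ‖covDerivFwd η U₀ p.2 lam p.1‖ ≤ α₄) ∧
      (∃ μ : ℕ → Site d → 𝔸, ∀ x ∈ Ω 0,
        covLap η U₀ ((Ω 0).indicator fun y => covDivB η U₀ A y + covLap η U₀ lam y +
          ((conjR (gaugeExp lam y)⁻¹ (covDivB η U₀ A y) - covDivB η U₀ A y) +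
            (gAd (covLap η U₀ lam y) (lam y) - covLap η U₀ lam y) + ∑ μ, frakF3 η U₀ lam A y μ)) x = QT L k Λs U₀ μ x) := by
  -- the letter R of (1.95)
  set R : (Site d → 𝔸) → (Site d → 𝔸) := fun f => f - g (qs (c (q (g f)))) with hRdef
  have hR : ∀ f, R f = f - g (qs (c (q (g f)))) := fun f => rfl
  have hRsub : ∀ f f' : Site d → 𝔸, R (f - f') = R f - R f' := proj325_sub (R := R) hR
  have hR0 : R 0 = 0 := by rw [hR]; simp
  have hRneg : ∀ f : Site d → 𝔸, R (-f) = -R f := fun f => by rw [← zero_sub, hRsub, hR0, zero_sub]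
  -- JOIN-A
  obtain ⟨s, s', hs, hfix, hs', hn', hsa', hoff', hN, hτ'⟩ := gaugeParam_kLevel_traceFree (Ω := Ω) (Eb := Eb) (U₀ := U₀) (A := A)
    (DA := fun y => covDivB η U₀ A y) τ hτ (hlog_of_tracial τ hτ) hL hη hU₀ hEbΩ (⇑g) R Hc hα₄.le hBG hBR hh₀ hh₂ hl₀ hl₁ hl₂ hcA hcA'
    hcDA ha₁' hb₁' hb₁ hθ hh₀' hh₁' hG (fun f f' => map_sub g f f') hGsupp hGreal hRsub hRbd hRreal hc0 hc1 hc2 hcL0 hcL1 hcL2 hcsa hcsupp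
    hDA hDAsa hA hAsa h103 h106 hDAτ hcτ hRτ hGτ
  set lam' := lamOf s' with hlam'def
  have hgp : lamOf s + Hc (lamOf s) = lam' := hs'.symm
  -- the Neumann solution at λ′
  set Z : Site d → 𝔸 := Zsol (Wsrc η U₀ A (fun y => covDivB η U₀ A y) lam' (covLap η U₀ (Hc (lamOf s)))) (Vop lam') R with hZdef
  -- the fixed point read through the projection laws: Q′λ = 0 and Δλ = R(−Z) on Ω₀
  have hfix' : lamOf s = g (R (fun x => -Z x)) := by
    have h := hfix
    simp only [PsiP5] at h
    rw [hgp] at h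
    exact h
  have hfix'' : lamOf s = g (R (-Z)) := hfix'
  have hqR : q (g (R (-Z))) = 0 := q_g_proj325_range (R := R) hR c_range (-Z)
  have hq : q (lamOf s) = 0 := by rw [hfix'']; exact hqR
  -- «ΔG′R = R» read POINTWISE on Ω₀ (the right-inverse law of G′ on print's domain)
  have hΔs : ∀ y ∈ Ω 0, Δ (lamOf s) y = R (-Z) y := fun y hy => by
    have h1 := g_rightΩ (R (-Z)) y hy
    rw [hqR, map_zero, map_zero, add_zero] at h1
    rw [hfix'']
    exact h1
  -- sizes at λ′ on Ω₀
  have hl : ∀ y ∈ Ω 0, ‖lam' y‖ ≤ 1 / 12 := fun y _ => by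
    rw [← hgp]; exact (gpar_size hc0 s hs y).trans (ha₁'.trans (by norm_num))
  -- support of λ_s (Dirichlet range of G′)
  have hoff : ∀ x, x ∉ Ω 0 → lamOf s x = 0 := fun x hx => by rw [hfix'']; exact hGsupp _ x hx
  have hind : (Ω 0).indicator (lamOf s) = lamOf s := by
    funext x
    by_cases hx : x ∈ Ω 0
    · rw [Set.indicator_of_mem hx]
    · rw [Set.indicator_of_notMem hx, hoff x hx]
  refine ⟨s, lam', hs, hq, hgp.symm, hsa', hoff', hτ', fun j hj p hp => ?_, ?_⟩
  · -- (1.108)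
    have h := (norm_le_iff hη.le s' hα₄.le).1 hn'
    exact ⟨h.1 p.1, h.2 j hj p hp⟩
  · -- the multiplier clause, via n04-b's WHY-Z bridge
    have hdef : lam' = lamOf s - (-Hc (lamOf s)) := by rw [sub_neg_eq_add, hgp]
    have hNy : ∀ y ∈ Ω 0, Z y + (gAd (R Z y) (lam' y) - R Z y) =
        conjR (gaugeExp lam' y)⁻¹ (covDivB η U₀ A y) - gAd (covLap η U₀ (-Hc (lamOf s)) y) (lam' y) + ∑ μ, frakF3 η U₀ lam' A y μ := by
      intro y hy
      have h := hN 0 (Nat.zero_le _) y hy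
      simp only [Vop, Wsrc] at h
      rw [h, covLap_neg', gAd_neg _ (hl y hy), sub_neg_eq_add]
    have hΔy : ∀ y ∈ Ω 0, covLap η U₀ (lamOf s) y = -R Z y := by
      intro y hy
      rw [← hind, ← hΔ _ y hy, hΔs y hy, hRneg, Pi.neg_apply]
    refine (multiplier_iff_of_whyZ L k (Ω 0) Λs U₀ A hdef hl hNy hΔy).2 ?_
    set φ := c (q (g Z)) with hφ
    refine ⟨φ - Aw (q (g (qs φ))), fun x hx => ?_⟩
    have hZR : Z - R Z = g (qs φ) := by rw [hR]; abel
    -- «ΔG′Q′ᵀφ = Q′ᵀ(φ − 𝔄Q′G′Q′ᵀφ)» read POINTWISE on Ω₀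
    have hlap : Δ (g (qs φ)) x = qs (φ - Aw (q (g (qs φ)))) x := by
      rw [map_sub, Pi.sub_apply]
      exact eq_sub_of_add_eq (by rw [← Pi.add_apply]; exact g_rightΩ (qs φ) x hx)
    rw [← hΔ _ x hx, hZR, hlap, hqs _ x hx]

/-- ★★ **THE SAME WITH A RESTRICTION PREDICATE TRANSFERRED FROM THE LINEAR CONSTRAINT, WITH THE TRACE-FREE CLAUSE**: for ANY `P : (Site d → 𝔸) → Prop` with the
displayed transfer `hP : ‖s‖ ≤ ¼α₄ → Q′λ_s = 0 → P (λ_s + H_cλ_s)`, the fixed point `λ′` of `hFP_kLevel_agnostic_RD_traceFree` satisfies `P λ′` — and is `τ`-free at every site.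
[cite: Balaban1985RegularSpaces, Prop. 5 (1.107) p.94, (1.113)–(1.114) p.95, (1.17) p.78] -/
theorem hFP_kLevel_ofConstraint_RD_traceFree (hL : 1 ≤ L) (hη : 0 < η) (hU₀ : ∀ x κ, U₀ x κ ∈ unitaryUnits 𝔸)
    (hEbΩ : ∀ j, j ≤ k → ∀ x ∈ Ω j, ∀ μ : Fin d, (x, μ) ∈ Eb j ∧ (x - e μ, μ) ∈ Eb j)
    (g Δ : (Site d → 𝔸) →ₗ[ℂ] (Site d → 𝔸)) (q : (Site d → 𝔸) →ₗ[ℂ] (ℕ → Site d → 𝔸)) (qs : (ℕ → Site d → 𝔸) →ₗ[ℂ] (Site d → 𝔸))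
    (Aw c : (ℕ → Site d → 𝔸) →ₗ[ℂ] (ℕ → Site d → 𝔸))
    (g_rightΩ : ∀ x, ∀ y ∈ Ω 0, (Δ (g x) + qs (Aw (q (g x)))) y = x y)
    (c_range : ∀ f, q (g (g (qs (c (q f))))) = q f)
    (hΔ : ∀ (f : Site d → 𝔸), ∀ x ∈ Ω 0, Δ f x = covLap η U₀ ((Ω 0).indicator f) x)
    (hqs : ∀ (μ : ℕ → Site d → 𝔸), ∀ x ∈ Ω 0, qs μ x = QT L k Λs U₀ μ x)
    (Hc : (Site d → 𝔸) → (Site d → 𝔸))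
    {α₄ BG BR h₀ h₁ h₂ l₀ l₁ l₂ cA cDA : ℝ}
    (hα₄ : 0 < α₄) (hBG : 0 ≤ BG) (hBR : 0 ≤ BR) (hh₀ : 0 ≤ h₀) (hh₂ : 0 ≤ h₂) (hl₀ : 0 ≤ l₀) (hl₁ : 0 ≤ l₁)
    (hl₂ : 0 ≤ l₂) (hcA : 0 ≤ cA) (hcA' : cA ≤ 1 / 13) (hcDA : 0 ≤ cDA)
    (ha₁' : α₄ / 4 + h₀ ≤ 1 / 24) (hb₁' : α₄ / 4 + h₁ ≤ 1 / 140) (hb₁ : 0 < α₄ / 4 + h₁) (hθ : 10 * (α₄ / 4 + h₀) * BR ≤ 1 / 2)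
    (hh₀' : h₀ ≤ 3 * α₄ / 4) (hh₁' : h₁ ≤ 3 * α₄ / 4)
    (hG : ∀ (f : Site d → 𝔸) (m : ℝ), 0 ≤ m → Bd2 L η k Ω f m →
      (∀ x, ‖g f x‖ ≤ BG * m) ∧ ∀ j, j ≤ k → ∀ p ∈ Eb j, wt L η j * ‖covDerivFwd η U₀ p.2 (g f) p.1‖ ≤ BG * m)
    (hGsupp : ∀ (f : Site d → 𝔸) (x : Site d), x ∉ Ω 0 → g f x = 0)
    (hGreal : ∀ f : Site d → 𝔸, (∀ j, j ≤ k → ∀ x ∈ Ω j, IsSelfAdjoint (f x)) → ∀ x, IsSelfAdjoint (g f x))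
    (hRbd : ∀ (f : Site d → 𝔸) (m : ℝ), 0 ≤ m → Bd2 L η k Ω f m → Bd2 L η k Ω (f - g (qs (c (q (g f))))) (BR * m))
    (hRreal : ∀ f : Site d → 𝔸, (∀ j, j ≤ k → ∀ x ∈ Ω j, IsSelfAdjoint (f x)) →
      ∀ j, j ≤ k → ∀ x ∈ Ω j, IsSelfAdjoint ((f - g (qs (c (q (g f))))) x))
    (hc0 : ∀ s : lamSubK η U₀ L k Eb, ‖s‖ ≤ α₄ / 4 → ∀ x, ‖Hc (lamOf s) x‖ ≤ h₀)
    (hc1 : ∀ s : lamSubK η U₀ L k Eb, ‖s‖ ≤ α₄ / 4 → ∀ j, j ≤ k → ∀ p ∈ Eb j, wt L η j * ‖covDerivFwd η U₀ p.2 (Hc (lamOf s)) p.1‖ ≤ h₁)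
    (hc2 : ∀ s : lamSubK η U₀ L k Eb, ‖s‖ ≤ α₄ / 4 → Bd2 L η k Ω (covLap η U₀ (Hc (lamOf s))) h₂)
    (hcL0 : ∀ s t : lamSubK η U₀ L k Eb, ‖s‖ ≤ α₄ / 4 → ‖t‖ ≤ α₄ / 4 → ∀ x, ‖Hc (lamOf s) x - Hc (lamOf t) x‖ ≤ l₀ * ‖s - t‖)
    (hcL1 : ∀ s t : lamSubK η U₀ L k Eb, ‖s‖ ≤ α₄ / 4 → ‖t‖ ≤ α₄ / 4 → ∀ j, j ≤ k → ∀ p ∈ Eb j,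
      wt L η j * ‖covDerivFwd η U₀ p.2 (Hc (lamOf s) - Hc (lamOf t)) p.1‖ ≤ l₁ * ‖s - t‖)
    (hcL2 : ∀ s t : lamSubK η U₀ L k Eb, ‖s‖ ≤ α₄ / 4 → ‖t‖ ≤ α₄ / 4 →
      Bd2 L η k Ω (covLap η U₀ (Hc (lamOf s)) - covLap η U₀ (Hc (lamOf t))) (l₂ * ‖s - t‖))
    (hcsa : ∀ s : lamSubK η U₀ L k Eb, ‖s‖ ≤ α₄ / 4 → (∀ x, IsSelfAdjoint (lamOf s x)) → ∀ x, IsSelfAdjoint (Hc (lamOf s) x))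
    (hcsupp : ∀ s : lamSubK η U₀ L k Eb, ‖s‖ ≤ α₄ / 4 → ∀ x, x ∉ Ω 0 → Hc (lamOf s) x = 0)
    (hDA : Bd2 L η k Ω (fun y => covDivB η U₀ A y) cDA) (hDAsa : ∀ j, j ≤ k → ∀ x ∈ Ω j, IsSelfAdjoint (covDivB η U₀ A x))
    (hA : ∀ j, j ≤ k → ∀ x ∈ Ω j, ∀ μ : Fin d,
      wt L η j * ‖A x μ‖ ≤ cA ∧ wt L η j * ‖conjR (U₀ (x - e μ) μ)⁻¹ (A (x - e μ) μ)‖ ≤ cA)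
    (hAsa : ∀ x μ, IsSelfAdjoint (A x μ))
    (h103 : BG * Mc d BR (α₄ / 4 + h₁) cA h₂ cDA ≤ α₄ / 4)
    (h106 : BG * Kc d BR (α₄ / 4 + h₁) cA h₂ cDA l₂ (1 + l₀) (1 + l₁) ≤ 1 / 2)
    -- `τ`-freeness of the datum, the correction and the letters (joint J-SU; (T2) discharged by `hlog_of_tracial`)
    (τ : 𝔸 →L[ℂ] ℂ) (hτ : ∀ x y : 𝔸, τ (x * y) = τ (y * x))
    (hDAτ : ∀ j, j ≤ k → ∀ x ∈ Ω j, τ (covDivB η U₀ A x) = 0)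
    (hcτ : ∀ s : lamSubK η U₀ L k Eb, ‖s‖ ≤ α₄ / 4 → (∀ x, τ (lamOf s x) = 0) → ∀ x, τ (Hc (lamOf s) x) = 0)
    (hRτ : ∀ f : Site d → 𝔸, (∀ j, j ≤ k → ∀ x ∈ Ω j, τ (f x) = 0) →
      ∀ j, j ≤ k → ∀ x ∈ Ω j, τ ((f - g (qs (c (q (g f))))) x) = 0)
    (hGτ : ∀ f : Site d → 𝔸, (∀ j, j ≤ k → ∀ x ∈ Ω j, τ (f x) = 0) → ∀ x, τ (g f x) = 0)
    -- the restriction: ANY predicate on the final gauge parameter, transferred from the linear constraint `Q′λ = 0`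
    (P : (Site d → 𝔸) → Prop)
    (hP : ∀ s : lamSubK η U₀ L k Eb, ‖s‖ ≤ α₄ / 4 → q (lamOf s) = 0 → P (lamOf s + Hc (lamOf s))) :
    ∃ lam : Site d → 𝔸, (∀ x, IsSelfAdjoint (lam x)) ∧ (∀ x, x ∉ Ω 0 → lam x = 0) ∧ (∀ x, τ (lam x) = 0) ∧
      (∀ j, j ≤ k → ∀ p ∈ Eb j, ‖lam p.1‖ ≤ α₄ ∧ wt L η j * ‖covDerivFwd η U₀ p.2 lam p.1‖ ≤ α₄) ∧
      (∃ μ : ℕ → Site d → 𝔸, ∀ x ∈ Ω 0,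
        covLap η U₀ ((Ω 0).indicator fun y => covDivB η U₀ A y + covLap η U₀ lam y +
          ((conjR (gaugeExp lam y)⁻¹ (covDivB η U₀ A y) - covDivB η U₀ A y) +
            (gAd (covLap η U₀ lam y) (lam y) - covLap η U₀ lam y) + ∑ μ, frakF3 η U₀ lam A y μ)) x = QT L k Λs U₀ μ x) ∧
      P lam := by
  obtain ⟨s, lam, hs, hq, hlam, hsa, hoff, hτlam, h108, hmult⟩ := hFP_kLevel_agnostic_RD_traceFree hL hη hU₀ hEbΩ g Δ q qs Aw c g_rightΩ
    c_range hΔ hqs Hc hα₄ hBG hBR hh₀ hh₂ hl₀ hl₁ hl₂ hcA hcA' hcDA ha₁' hb₁' hb₁ hθ hh₀' hh₁' hG hGsupp hGreal hRbd hRreal hc0 hc1 hc2 hcL0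
    hcL1 hcL2 hcsa hcsupp hDA hDAsa hA hAsa h103 h106 τ hτ hDAτ hcτ hRτ hGτ
  exact ⟨lam, hsa, hoff, hτlam, h108, hmult, hlam ▸ hP s hs hq⟩

end GenericTraceFree

end Summit.QuantumFields.YangMills.Theorems.HalvingP1FlatCoreTopStep

end
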